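import Summits.BirchSwinnertonDyer.BirchSwinnertonDyer.Theorems.SmallImageMuTransferMuTransferX9TameGeneratorSeams
import Summits.BirchSwinnertonDyer.BirchSwinnertonDyer.Theorems.SmallImageMuTransferMuTransferX9LocalFrobeniusFixer
import HarnessLib

/-!
# K6 crux `MuTransferX9` (stmt-BirchSwinnertonDyer-19276), skeleton v6 stub `stub_stepsTwoFourOdd`:
# CURRENCY BRIDGES `ℓ = primesEquiv q` ↔ `ℓ = Ideal.absNorm q.asIdeal` for the binders of koly's STEP 4
# that carry `ℓ` through instance arguments (`hgen`, `χ̄_ℓ(r) = 1`, `Fact ℓ.Prime`, `NeZero (ℓ : ℚ_q)`, `hpl`)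

Cell `b2b-bsdres` (X9 prover lineage, GEN 45) serving the K6 route `SmallImageMuTransfer` of cell
`bsd-smallim`.  HONEST FRAMING: the cell deletes COMBINATION-SHAPED residual classes of the rank-≤1
BSD formula from PUBLISHED theorems only and TYPES the construction-shaped remainder; this is not
"finishing BSD"; class X9 stays TYPED at class level.  `--supports` helper toward
stmt-BirchSwinnertonDyer-19276 (`stub_stepsTwoFourOdd` of skeleton v6 `a90a661b046bb403` / v6d);
books nothing, closes nothing; THEOREMS ONLY (no definition, no named fact, no `sorry`).  Sequel of
`…X9TameGeneratorSeams` (p469046) and `…X9LocalFrobeniusFixer` (p469979).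

## Why / What

The Kolyvagin package on the assembly interface (lur-b's `hKoly`, HOME(bsd-smallim)/lurb/STEPS24-hKoly;
x10's `KolyvaginTwist.exists_kolyvaginCocycle_value`) is keyed on `ℓ = primesEquiv q`: `hgen` reads
`∀ u : (ZMod ℓ)ˣ, u ∈ Subgroup.zpowers (χ̄_ℓ^{ℚ_q} τq)`, the transverse condition uses
`CyclotomicField ℓ ℚ_q`, the instances are `[Fact ℓ.Prime] [NeZero (ℓ : ℚ_q)]`.  koly's STEP 4
(`LocalSplitPrime.convCoeff_eq_zero_of_transverse_of_unramified`, section `Joined`) is keyed on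
`ℓ = Ideal.absNorm q.asIdeal` with instances `[Fact (N q).Prime] [NeZero (N q : ℚ_q)]`.  The two
spellings agree (`LFunctions.absNorm_asIdeal_eq_primesEquiv`), but the binders carry `ℓ` through
INSTANCE arguments, so a plain `rw` does not move them.  This file: `…_congr` lemmas by `subst`
(the instance arguments are propositions), their specialisations at `q`
(`forall_mem_zpowers_modPCyclotomicCharacterZMod_absNorm_iff` = koly's `hgen` ↔ the interface's
`hgen`; `modPCyclotomicCharacterZMod_absNorm_eq_one_iff`; `dvd_absNorm_sub_one_iff` = koly's `hpl` ↔
k6-g3's `hdvd`), and the instance facts themselves as theorems (`fact_prime_absNorm`,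
`neZero_absNorm_adicCompletion`, `neZero_primesEquiv_adicCompletion` — `ℚ → ℚ_q` is injective), so
that the assembler can `haveI` them.  The `hcq` bridge is
`TameSeams.mem_transverseSubgroup_cyclotomicField_absNorm_iff` (p469046 §2).

PARTITION (D-0054): X9 (A4) · X10b∧¬Surj (A5) at `p = 3` — Galois-side seam helper toward
`stub_stepsTwoFourOdd`; closes NONE.

References: K. Rubin, PCMI 18 (2011) Def. 1.9.4, Prop. 1.9.5 [Rubin2011]; J. Neukirch, *Algebraic
Number Theory* (1999) Ch. I (10.3), Ch. II (9.6) [NeukirchANT1999]; HOME/koly/MU-TRANSFER-PROOF.md §5 STEP 4.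
-/

-- the summit and its single problem are both named `BirchSwinnertonDyer` (registry layout D-0017)
set_option linter.dupNamespace false

set_option autoImplicit false

noncomputable section

open Function
open scoped NumberField
open Field IsDedekindDomain NumberField
open Literature.NumberTheory.GaloisRepresentations
open Rat.HeightOneSpectrum

namespace Summit.BirchSwinnertonDyer.BirchSwinnertonDyer.Rank1Residual.TameSeams

/-! ## §1 Transport along an equality of the index, through the instance arguments -/

/-- **Transport of koly's `hgen` binder along an equality of the index**: for `a = b` (both prime,
both nonzero in `F`), "`χ̄_a^F(τ)` generates `(ℤ/a)ˣ`" iff "`χ̄_b^F(τ)` generates `(ℤ/b)ˣ`" — the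
instance arguments on the two sides are propositions, so after `subst` the two statements agree
definitionally. [cite: Rubin2011, Def. 1.9.4] -/
theorem forall_mem_zpowers_modPCyclotomicCharacterZMod_congr {F : Type*} [Field F] {a b : ℕ}
    (h : a = b) [Fact a.Prime] [Fact b.Prime] [NeZero ((a : ℕ) : F)] [NeZero ((b : ℕ) : F)]
    (τ : absoluteGaloisGroup F) :
    (∀ u : (ZMod a)ˣ, u ∈ Subgroup.zpowers (modPCyclotomicCharacterZMod F a τ)) ↔
      (∀ u : (ZMod b)ˣ, u ∈ Subgroup.zpowers (modPCyclotomicCharacterZMod F b τ)) := by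
  subst h
  exact Iff.rfl

/-- The same transport for "`χ̄_a^F(τ) = 1`" (the local-Frobenius clause). [cite: Rubin2011, Def. 1.9.4] -/
theorem modPCyclotomicCharacterZMod_eq_one_congr {F : Type*} [Field F] {a b : ℕ}
    (h : a = b) [Fact a.Prime] [Fact b.Prime] [NeZero ((a : ℕ) : F)] [NeZero ((b : ℕ) : F)]
    (τ : absoluteGaloisGroup F) :
    modPCyclotomicCharacterZMod F a τ = 1 ↔ modPCyclotomicCharacterZMod F b τ = 1 := by
  subst h
  exact Iff.rfl

/-- The same transport for the surjectivity of `χ̄` on inertia (koly's `hχI` binder shape).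
[cite: Rubin2011, Def. 1.9.4] -/
theorem forall_exists_mem_modPCyclotomicCharacterZMod_eq_congr {F : Type*} [Field F] {a b : ℕ}
    (h : a = b) [Fact a.Prime] [Fact b.Prime] [NeZero ((a : ℕ) : F)] [NeZero ((b : ℕ) : F)]
    (I : Subgroup (absoluteGaloisGroup F)) :
    (∀ u : (ZMod a)ˣ, ∃ t ∈ I, modPCyclotomicCharacterZMod F a t = u) ↔
      (∀ u : (ZMod b)ˣ, ∃ t ∈ I, modPCyclotomicCharacterZMod F b t = u) := by
  subst h
  exact Iff.rfl

/-! ## §2 At a finite place `q` of `ℚ` -/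

/-- **`Fact (N q).Prime`** (from `N q = primesEquiv q`), as a theorem the assembler can `haveI`.
[cite: NeukirchANT1999, Ch. I (10.3)] -/
theorem fact_prime_absNorm (q : HeightOneSpectrum (𝓞 ℚ)) : Fact (Ideal.absNorm q.asIdeal).Prime := by
  rw [Literature.NumberTheory.LFunctions.absNorm_asIdeal_eq_primesEquiv]
  exact ⟨(primesEquiv q).2⟩

/-- `NeZero (N q : ℚ_q)` — koly's section instance, discharged. [cite: NeukirchANT1999, Ch. II (9.6)] -/
theorem neZero_absNorm_adicCompletion (q : HeightOneSpectrum (𝓞 ℚ)) :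
    NeZero ((Ideal.absNorm q.asIdeal : ℕ) : q.adicCompletion ℚ) :=
  haveI : NeZero (Ideal.absNorm q.asIdeal) := ⟨(fact_prime_absNorm q).out.ne_zero⟩
  neZero_natCast_adicCompletion q _

/-- `NeZero (primesEquiv q : ℚ_q)` — the interface's instance, discharged.
[cite: NeukirchANT1999, Ch. II (9.6)] -/
theorem neZero_primesEquiv_adicCompletion (q : HeightOneSpectrum (𝓞 ℚ)) :
    NeZero ((((primesEquiv q : Nat.Primes) : ℕ) : ℕ) : q.adicCompletion ℚ) :=
  haveI : NeZero ((primesEquiv q : Nat.Primes) : ℕ) := ⟨(primesEquiv q).2.ne_zero⟩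
  neZero_natCast_adicCompletion q _

/-- **koly's `hgen` ↔ the interface's `hgen`**: at a finite place `q` of `ℚ` and any
`τ ∈ Γ_{ℚ_q}`, "`χ̄_{N q}^{ℚ_q}(τ)` generates `(ℤ/N q)ˣ`" (the binder of
`LocalSplitPrime.convCoeff_eq_zero_of_transverse_of_unramified`) iff "`χ̄_ℓ^{ℚ_q}(τ)` generates
`(ℤ/ℓ)ˣ`", `ℓ = primesEquiv q` (the clause of x10's `exists_kolyvaginCocycle_value` / lur-b's
`hKoly`). [cite: Rubin2011, Def. 1.9.4 and Prop. 1.9.5] -/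
theorem forall_mem_zpowers_modPCyclotomicCharacterZMod_absNorm_iff (q : HeightOneSpectrum (𝓞 ℚ))
    [Fact (Ideal.absNorm q.asIdeal).Prime] [NeZero ((Ideal.absNorm q.asIdeal : ℕ) : q.adicCompletion ℚ)]
    [Fact (((primesEquiv q : Nat.Primes) : ℕ)).Prime]
    [NeZero ((((primesEquiv q : Nat.Primes) : ℕ) : ℕ) : q.adicCompletion ℚ)]
    (τ : absoluteGaloisGroup (q.adicCompletion ℚ)) :
    (∀ u : (ZMod (Ideal.absNorm q.asIdeal))ˣ,
        u ∈ Subgroup.zpowers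
          (modPCyclotomicCharacterZMod (q.adicCompletion ℚ) (Ideal.absNorm q.asIdeal) τ)) ↔
      (∀ u : (ZMod ((primesEquiv q : Nat.Primes) : ℕ))ˣ,
        u ∈ Subgroup.zpowers
          (modPCyclotomicCharacterZMod (q.adicCompletion ℚ) ((primesEquiv q : Nat.Primes) : ℕ) τ)) :=
  forall_mem_zpowers_modPCyclotomicCharacterZMod_congr
    (Literature.NumberTheory.LFunctions.absNorm_asIdeal_eq_primesEquiv q) τ

/-- **`χ̄_{N q}^{ℚ_q}(r) = 1 ↔ χ̄_ℓ^{ℚ_q}(r) = 1`**, `ℓ = primesEquiv q`. [cite: Rubin2011, Def. 1.9.4] -/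
theorem modPCyclotomicCharacterZMod_absNorm_eq_one_iff (q : HeightOneSpectrum (𝓞 ℚ))
    [Fact (Ideal.absNorm q.asIdeal).Prime] [NeZero ((Ideal.absNorm q.asIdeal : ℕ) : q.adicCompletion ℚ)]
    [Fact (((primesEquiv q : Nat.Primes) : ℕ)).Prime]
    [NeZero ((((primesEquiv q : Nat.Primes) : ℕ) : ℕ) : q.adicCompletion ℚ)]
    (r : absoluteGaloisGroup (q.adicCompletion ℚ)) :
    modPCyclotomicCharacterZMod (q.adicCompletion ℚ) (Ideal.absNorm q.asIdeal) r = 1 ↔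
      modPCyclotomicCharacterZMod (q.adicCompletion ℚ) ((primesEquiv q : Nat.Primes) : ℕ) r = 1 :=
  modPCyclotomicCharacterZMod_eq_one_congr
    (Literature.NumberTheory.LFunctions.absNorm_asIdeal_eq_primesEquiv q) r

/-- **koly's `hχI` ↔ the `primesEquiv` spelling** (surjectivity of `χ̄` on `absInertia ℚ_q`); over
`ℚ` both hold outright (`Rat.modPCyclotomicCharacterZMod_surjOn_absInertia_adicCompletion`, b2b
`modPCyclotomicCharacter_surjOn_absInertia_rat_holds`). [cite: Rubin2011, Def. 1.9.4] -/
theorem forall_exists_mem_absInertia_modPCyclotomicCharacterZMod_absNorm_iff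
    (q : HeightOneSpectrum (𝓞 ℚ))
    [Fact (Ideal.absNorm q.asIdeal).Prime] [NeZero ((Ideal.absNorm q.asIdeal : ℕ) : q.adicCompletion ℚ)]
    [Fact (((primesEquiv q : Nat.Primes) : ℕ)).Prime]
    [NeZero ((((primesEquiv q : Nat.Primes) : ℕ) : ℕ) : q.adicCompletion ℚ)] :
    (∀ u : (ZMod (Ideal.absNorm q.asIdeal))ˣ, ∃ t ∈ absInertia (q.adicCompletion ℚ),
        modPCyclotomicCharacterZMod (q.adicCompletion ℚ) (Ideal.absNorm q.asIdeal) t = u) ↔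
      (∀ u : (ZMod ((primesEquiv q : Nat.Primes) : ℕ))ˣ, ∃ t ∈ absInertia (q.adicCompletion ℚ),
        modPCyclotomicCharacterZMod (q.adicCompletion ℚ) ((primesEquiv q : Nat.Primes) : ℕ) t = u) :=
  forall_exists_mem_modPCyclotomicCharacterZMod_eq_congr
    (Literature.NumberTheory.LFunctions.absNorm_asIdeal_eq_primesEquiv q) _

/-- **`p ∣ N q − 1 ↔ p ∣ ℓ − 1`**, `ℓ = primesEquiv q` (koly's `hpl` vs k6-g3's `hdvd`).
[cite: NeukirchANT1999, Ch. I (10.3)] -/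
theorem dvd_absNorm_sub_one_iff (q : HeightOneSpectrum (𝓞 ℚ)) (p : ℕ) :
    p ∣ Ideal.absNorm q.asIdeal - 1 ↔ p ∣ ((primesEquiv q : Nat.Primes) : ℕ) - 1 := by
  rw [Literature.NumberTheory.LFunctions.absNorm_asIdeal_eq_primesEquiv]

end Summit.BirchSwinnertonDyer.BirchSwinnertonDyer.Rank1Residual.TameSeams

end
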